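import Summits.Ventures.YMGap.Thresholds.StarWindowBoundDim
import Summits.Ventures.YMGap.Thresholds.StarTransferZd
import Summits.Ventures.YMGap.Thresholds.QuarterModulusOneHalf
import Literature.MathematicalPhysics.QuantumFieldTheory.Balaban1983to89.StrongCouplingKernelWindow
import HarnessLib

/-!
# Venture YMGap — track (c) «DS» in GENERAL DIMENSION `d`: the vertex-star ROWS — torus clustering uniform
# in the volume, DLR uniqueness on `ℤ^d`, unique thermodynamic limit — for `SU(2)` at every
# `0 ≤ β_W < β⋆_G(d) = (√(4d²−8d+5) − (2d−3))/(d−1)` and for every `SU(N)` from any one-link modulus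

HONEST FRAMING: venture file (cell `pub-ymgap`, seat ds-4; the DIMENSION column of the cell's `β₀(N, d)`
table, STAR-DIMENSIONS.md, class A → K), strong-coupling LATTICE statements (SC-a currency: the
Dobrushin–Shlosman window condition with vertex-star windows ⇒ exponential clustering of link observables
of the torus Wilson measure uniformly in the side, and `|𝒢| = 1` + convergence of the torus states on
`ℤ^d`) for `SU(N)` lattice Yang–Mills on `(ℤ/L)^d` / `ℤ^d` with the Wilson plaquette weight
`exp(−β (N − Re tr U_q))`; nothing about the continuum, confinement at weak coupling, or the mass gap.
ARITHMETIC over tree theorems: the generic-(`N`, `d`) star window `StarLemmaGDimSUN.star_window_of_*`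
(this seat), the any-`d` torus door `DSWindow.star_abs_covariance_le`, the any-`d` `ℤ^d` doors
`DSWindowZd.hasUniqueGibbsMeasure_of_isLinkWindowContraction` / `starWindowBoundZd_of_isLinkWindowContraction`
/ `hasUniqueInfiniteVolumeLimit_of_starWindowBoundZd` (ds-1), the `SU(2)` quarter modulus on tilts `≤ 3/4`
(`QuarterModulusOneHalf.oneLinkKRModulusSU2_of_le_oneHalf`, i.e. `OneLinkKRModulus 2 (3/4) 1`), and the
hypothesis-free Bakry–Émery modulus `oneLinkKRModulus_SU` (`K = 1/(1/2 − R)`).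

NUMBERS (`SU(2)`, Wilson `β_W`, tree coupling `β_W/2`, per-incidence coefficient `c = β_W/4`).  The ONLY
condition is the door `(4d−4)c² + (4d−6)c < 1`, i.e. `β_W < β⋆_G(d)`; the quarter-modulus tilt condition
`(d−1)β_W/2 ≤ 3/4` FOLLOWS from it in every `d ≥ 2` (`tilt_le_of_door`).  Closed form in every `d`:
uniqueness + unique limit at every `0 ≤ β_W ≤ 8/(9(d−1))` (`4/3 ×` the single-site door).  Rows: `d = 3`: every
`0 ≤ β_W ≤ 5/9 = 0.5556` (door `0.5616`; single-site `1/3`); `d = 4`: `β_W ≤ 9/25` re-derived (the row of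
record stays `StarLemmaGRows`/`StarInfiniteVolume`, p329517/p330031); `d = 5`: `β_W ≤ 13/50 = 0.26` (door
`0.2656`; single-site `1/6`); `d = 6`: `β_W ≤ 1/5` (door `0.2100`; single-site `2/15`).  `SU(N)`, `N ≥ 2`,
Bakry–Émery, CLOSED FORM IN EVERY `d`: DLR uniqueness + unique limit at every 't Hooft
`|β|/N ≤ 1/(12(d−1))` (printed single-site `1/(16(d−1))`: `× 4/3` uniformly in `d`); `d = 3` row
`|β|/N ≤ 2/45 = 0.0444` (printed `1/32 = 0.03125`).
-/

noncomputable section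

open MeasureTheory Function Finset ProbabilityTheory
open Literature.Probability.LatticeModels
open Literature.MathematicalPhysics.QuantumLattice (fundamentalRep ymSpecification HasUniqueInfiniteVolumeLimit)
open Literature.MathematicalPhysics.QuantumFieldTheory
open Literature.MathematicalPhysics.QuantumFieldTheory.Balaban1983to89.StrongCouplingDobrushinWindow
  (OneLinkKRModulus)
open Literature.MathematicalPhysics.QuantumFieldTheory.Balaban1983to89.StrongCouplingTorusWindow
  (wilsonPlaqWeight wilsonMeasure_eq_groupHeatKernelMeasure continuous_wilsonPlaqWeight wilsonPlaqWeight_pos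
  isKRContraction_torusWilson)
open Literature.MathematicalPhysics.QuantumFieldTheory.Balaban1983to89.StrongCouplingKernelWindow
  (oneLinkKRModulus_SU)
open Summit.Ventures.YMGap.DSWindow
open Summit.Ventures.YMGap.DSWindowZd
open Summit.Ventures.YMGap.StarResolventDim
open Summit.Ventures.YMGap.StarLemmaGDim (Karr)
open Summit.Ventures.YMGap.StarLemmaGDimSUN

namespace Summit.Ventures.YMGap.StarDimRows

variable {d L : ℕ} [NeZero L] {N : ℕ}

/-! ### Small arithmetic: the door condition already bounds the tilt -/

omit [NeZero L] in
/-- The door condition bounds the tilt radius: `d ≥ 2`, `c ≥ 0`, `(4d−4)c² + (4d−6)c < 1` give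
`c(d−1) ≤ 3/8` (so for `SU(2)`, `c = β_W/4`: `(d−1)β_W/2 ≤ 3/4`, inside `QuarterModulusOneHalf`).
[folklore] -/
theorem tilt_le_of_door (hd : 2 ≤ d) {c : ℝ} (h0 : 0 ≤ c) (h : doorPoly d c < 1) :
    c * ((d : ℝ) - 1) ≤ 3 / 8 := by
  have hd' : (2 : ℝ) ≤ d := by exact_mod_cast hd
  unfold doorPoly at h
  by_contra hneg
  have hneg : 3 / 8 < c * ((d : ℝ) - 1) := lt_of_not_ge hneg
  have h1 : (4 * (d : ℝ) - 4) * c ^ 2 ≥ 3 / 2 * c := by nlinarith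
  have h2 : (4 * (d : ℝ) - 9 / 2) * c < 1 := by nlinarith
  nlinarith

/-! ### The three rows from ANY one-link modulus (`SU(N)`, dimension `d`) -/

/-- **Torus clustering, uniformly in the side, from a one-link modulus, dimension `d`.**  `SU(N)` Wilson
action on `(ℤ/L)^d`, `d ≥ 2`, `L ≥ 3`, tree coupling `β`; a one-link modulus `OneLinkKRModulus N R K`
(`K ≥ 0`) on the tilt ball `R ≥ 2(d−1)|β|/N` whose per-incidence coefficient `c = K|β|/N` satisfies the door
`(4d−4)c² + (4d−6)c < 1`.  Then for admissible link observables `f, g` whose links' endpoints are `≥ L₀`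
apart in the periodic sup-distance,
`|cov(f,g)| ≤ 4(2√N)² exp(−(1−ρ)² L₀/(2(4dρ+1))) (Σδf)(Σδg)`, `ρ = R_G^{(d)}(c) < 1`, under the torus
Wilson measure — `DSWindow.star_abs_covariance_le` on `StarLemmaGDimSUN.star_window_of_oneLinkKRModulus`.
Constants independent of `L`. [folklore] -/
theorem abs_covariance_le_of_oneLinkKRModulus (hd : 2 ≤ d) (hL : 3 ≤ L) (hN : 1 ≤ N) {β R K : ℝ}
    (hK0 : 0 ≤ K) (hR : |β| / N * (2 * ((d : ℝ) - 1)) ≤ R) (hmod : OneLinkKRModulus N R K)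
    (h : doorPoly d (K * (|β| / N)) < 1)
    {f g : GaugeConfig d L (Matrix.specialUnitaryGroup (Fin N) ℂ) → ℝ} {Δf Δg : Finset (Edge d L)}
    {δf δg : Edge d L → ℝ} (hf : LinkObs suFrobDist f Δf δf) (hg : LinkObs suFrobDist g Δg δg)
    (L₀ : ℕ) (hL₀ : ∀ x ∈ Δf, ∀ z ∈ Δg, ∀ a ∈ linkEnds x, ∀ w ∈ linkEnds z, L₀ ≤ torusNorm (a - w)) :
    |cov[f, g; wilsonMeasure (d := d) (L := L) (fundamentalRep (Fin N)) β]| ≤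
      4 * (2 * Real.sqrt N) ^ 2 *
        Real.exp (-((1 - gaugeR d (K * (|β| / N))) ^ 2 /
          (2 * (2 * gaugeR d (K * (|β| / N)) * (2 * d : ℕ) + 1)) * L₀)) *
        (∑ x ∈ Δf, δf x) * ∑ y ∈ Δg, δg y := by
  haveI : SecondCountableTopology (Matrix (Fin N) (Fin N) ℂ) :=
    inferInstanceAs (SecondCountableTopology (Fin N → Fin N → ℂ))
  haveI : SecondCountableTopology (Matrix.specialUnitaryGroup (Fin N) ℂ) :=
    Topology.IsEmbedding.subtypeVal.secondCountableTopology
  have hc0 : 0 ≤ K * (|β| / N) := mul_nonneg hK0 (by positivity)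
  obtain ⟨hK, hKloc, hH1, hH2⟩ := star_window_of_oneLinkKRModulus (L := L) hd hL hN hK0 hR hmod h
  obtain ⟨hρ0, hρ1⟩ := gaugeR_lt_one_of_door hd hc0 h
  rw [wilsonMeasure_eq_groupHeatKernelMeasure]
  exact star_abs_covariance_le (continuous_wilsonPlaqWeight (N := N) β) (wilsonPlaqWeight_pos (N := N) β)
    (R := 2 * Real.sqrt N) (by positivity) suFrobDist_le hK hKloc hH1 hρ0 hρ1
    (fun s x hx => (hH2 s x hx).le) hf hg L₀ hL₀

/-- Generic-side form of the uniqueness row in dimension `d` (the torus side `L ≥ 5` is a dummy: the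
conclusion lives on `ℤ^d`; instantiated at `L = 5` below). [folklore] -/
theorem hasUniqueGibbsMeasure_of_oneLinkKRModulus_side (hd : 2 ≤ d) (hL : 5 ≤ L) (hN : 1 ≤ N)
    {β R K : ℝ} (hK0 : 0 ≤ K) (hR : |β| / N * (2 * ((d : ℝ) - 1)) ≤ R) (hmod : OneLinkKRModulus N R K)
    (h : doorPoly d (K * (|β| / N)) < 1) :
    HasUniqueGibbsMeasure (ymSpecification (d := d) (fundamentalRep (Fin N)) β) := by
  have hc0 : 0 ≤ K * (|β| / N) := mul_nonneg hK0 (by positivity)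
  obtain ⟨hK, -, hH1, hH2⟩ := star_window_of_oneLinkKRModulus (L := L) hd (by omega) hN hK0 hR hmod h
  obtain ⟨hρ0, hρ1⟩ := gaugeR_lt_one_of_door hd hc0 h
  exact hasUniqueGibbsMeasure_of_isLinkWindowContraction hL hρ0 hρ1 hK hH1
    fun t x hx => (hH2 t x hx).le

/-- Generic-side form of the thermodynamic-limit row in dimension `d` (instantiated at `L = 5` below).
[folklore] -/
theorem hasUniqueInfiniteVolumeLimit_of_oneLinkKRModulus_side (hd : 2 ≤ d) (hL : 5 ≤ L) (hN : 1 ≤ N)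
    {β R K : ℝ} (hK0 : 0 ≤ K) (hR : |β| / N * (2 * ((d : ℝ) - 1)) ≤ R) (hmod : OneLinkKRModulus N R K)
    (h : doorPoly d (K * (|β| / N)) < 1) :
    HasUniqueInfiniteVolumeLimit (d := d) (fundamentalRep (Fin N)) β := by
  have hc0 : 0 ≤ K * (|β| / N) := mul_nonneg hK0 (by positivity)
  obtain ⟨hK, -, hH1, hH2⟩ := star_window_of_oneLinkKRModulus (L := L) hd (by omega) hN hK0 hR hmod h
  obtain ⟨hρ0, hρ1⟩ := gaugeR_lt_one_of_door hd hc0 h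
  exact hasUniqueInfiniteVolumeLimit_of_starWindowBoundZd β hρ0 hρ1
    (starWindowBoundZd_of_isLinkWindowContraction hL suFrobDist_nonneg hK hH1
      fun t x hx => (hH2 t x hx).le)

omit [NeZero L] in
/-- **DLR uniqueness on `ℤ^d` from a one-link modulus** (`SU(N)`, any `N ≥ 1`, any `d ≥ 2`):
`OneLinkKRModulus N R K`, `K ≥ 0`, `R ≥ 2(d−1)|β|/N`, door `(4d−4)c² + (4d−6)c < 1` at `c = K|β|/N` ⇒ the
infinite-volume Wilson specification `ymSpecification (fundamentalRep (Fin N)) β` on `ℤ^d` has exactly one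
DLR state (the window on the torus of side `5` fed into the `ℤ^d` door). [folklore] -/
theorem hasUniqueGibbsMeasure_of_oneLinkKRModulus (hd : 2 ≤ d) (hN : 1 ≤ N) {β R K : ℝ} (hK0 : 0 ≤ K)
    (hR : |β| / N * (2 * ((d : ℝ) - 1)) ≤ R) (hmod : OneLinkKRModulus N R K)
    (h : doorPoly d (K * (|β| / N)) < 1) :
    HasUniqueGibbsMeasure (ymSpecification (d := d) (fundamentalRep (Fin N)) β) :=
  hasUniqueGibbsMeasure_of_oneLinkKRModulus_side (L := 5) hd le_rfl hN hK0 hR hmod h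

omit [NeZero L] in
/-- **Unique thermodynamic limit from a one-link modulus** (`SU(N)`, any `d ≥ 2`): under the same
hypotheses the full sequence of torus Wilson states converges on bounded continuous cylinder observables and
has exactly one limit point (`HasUniqueInfiniteVolumeLimit`). [folklore] -/
theorem hasUniqueInfiniteVolumeLimit_of_oneLinkKRModulus (hd : 2 ≤ d) (hN : 1 ≤ N) {β R K : ℝ}
    (hK0 : 0 ≤ K) (hR : |β| / N * (2 * ((d : ℝ) - 1)) ≤ R) (hmod : OneLinkKRModulus N R K)
    (h : doorPoly d (K * (|β| / N)) < 1) :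
    HasUniqueInfiniteVolumeLimit (d := d) (fundamentalRep (Fin N)) β :=
  hasUniqueInfiniteVolumeLimit_of_oneLinkKRModulus_side (L := 5) hd le_rfl hN hK0 hR hmod h

/-! ### `SU(2)` in dimension `d`: the sharp quarter modulus, every `0 ≤ β_W < β⋆_G(d)` -/

omit [NeZero L] in
/-- The `SU(2)` quarter-modulus inputs in dimension `d` at Wilson coupling `β_W ≥ 0` below the door:
`K = 1 ≥ 0`, the tilt `|β_W/2|/2 · 2(d−1) ≤ 3/4`, the modulus `OneLinkKRModulus 2 (3/4) 1`
(`QuarterModulusOneHalf` at `β_W = 1/2`), and the door in the coefficient `1 · (|β_W/2|/2) = β_W/4`.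
[folklore] -/
theorem su2_inputs (hd : 2 ≤ d) {βW : ℝ} (h0 : 0 ≤ βW) (h : doorPoly d (βW / 4) < 1) :
    |βW / 2| / (2 : ℕ) * (2 * ((d : ℝ) - 1)) ≤ 3 / 4 ∧ OneLinkKRModulus 2 (3 / 4) 1 ∧
      (1 : ℝ) * (|βW / 2| / (2 : ℕ)) = βW / 4 := by
  have habs : |βW / 2| / ((2 : ℕ) : ℝ) = βW / 4 := by
    rw [abs_of_nonneg (by linarith)]; push_cast; ring
  have htilt := tilt_le_of_door hd (by linarith : 0 ≤ βW / 4) h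
  refine ⟨?_, ?_, by rw [habs, one_mul]⟩
  · rw [habs]; nlinarith
  · have hm := Summit.Ventures.YMGap.QuarterModulusOneHalf.oneLinkKRModulusSU2_of_le_oneHalf
      (βW := 1 / 2) le_rfl
    unfold Balaban1983to89.StrongCouplingDobrushinWindow.OneLinkKRModulusSU2 at hm
    norm_num at hm
    exact hm

/-- **`SU(2)`, dimension `d`: TORUS CLUSTERING uniformly in the side at every `0 ≤ β_W` below the door**
(`(4d−4)c² + (4d−6)c < 1`, `c = β_W/4`, i.e. `β_W < β⋆_G(d)`), `L ≥ 3`: for admissible link observables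
whose links' endpoints are `≥ L₀` apart,
`|cov(f,g)| ≤ 32 exp(−(1−ρ)² L₀/(2(4dρ+1))) (Σδf)(Σδg)`, `ρ = R_G^{(d)}(β_W/4) < 1`, under the torus Wilson
measure at tree coupling `β_W/2`. [folklore] -/
theorem su2_abs_covariance_le (hd : 2 ≤ d) (hL : 3 ≤ L) {βW : ℝ} (h0 : 0 ≤ βW)
    (h : doorPoly d (βW / 4) < 1)
    {f g : GaugeConfig d L (Matrix.specialUnitaryGroup (Fin 2) ℂ) → ℝ} {Δf Δg : Finset (Edge d L)}
    {δf δg : Edge d L → ℝ} (hf : LinkObs suFrobDist f Δf δf) (hg : LinkObs suFrobDist g Δg δg)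
    (L₀ : ℕ) (hL₀ : ∀ x ∈ Δf, ∀ z ∈ Δg, ∀ a ∈ linkEnds x, ∀ w ∈ linkEnds z, L₀ ≤ torusNorm (a - w)) :
    |cov[f, g; wilsonMeasure (d := d) (L := L) (fundamentalRep (Fin 2)) (βW / 2)]| ≤
      4 * (2 * Real.sqrt (2 : ℕ)) ^ 2 *
        Real.exp (-((1 - gaugeR d (βW / 4)) ^ 2 /
          (2 * (2 * gaugeR d (βW / 4) * (2 * d : ℕ) + 1)) * L₀)) *
        (∑ x ∈ Δf, δf x) * ∑ y ∈ Δg, δg y := by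
  obtain ⟨hR, hmod, hc⟩ := su2_inputs hd h0 h
  have h' : doorPoly d (1 * (|βW / 2| / (2 : ℕ))) < 1 := by rw [hc]; exact h
  have key := abs_covariance_le_of_oneLinkKRModulus (N := 2) hd hL (by norm_num) zero_le_one hR hmod h'
    hf hg L₀ hL₀
  rw [hc] at key
  exact key

omit [NeZero L] in
/-- **`SU(2)`, dimension `d`: DLR UNIQUENESS on `ℤ^d` and UNIQUE THERMODYNAMIC LIMIT at every `0 ≤ β_W`
below the door** (`β_W < β⋆_G(d)`; tree coupling `β_W/2`) — hypothesis-free. [folklore] -/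
theorem su2_unique_of_door (hd : 2 ≤ d) {βW : ℝ} (h0 : 0 ≤ βW) (h : doorPoly d (βW / 4) < 1) :
    HasUniqueGibbsMeasure (ymSpecification (d := d) (fundamentalRep (Fin 2)) (βW / 2)) ∧
      HasUniqueInfiniteVolumeLimit (d := d) (fundamentalRep (Fin 2)) (βW / 2) := by
  obtain ⟨hR, hmod, hc⟩ := su2_inputs hd h0 h
  have h' : doorPoly d (1 * (|βW / 2| / (2 : ℕ))) < 1 := by rw [hc]; exact h
  exact ⟨hasUniqueGibbsMeasure_of_oneLinkKRModulus (N := 2) hd (by norm_num) zero_le_one hR hmod h',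
    hasUniqueInfiniteVolumeLimit_of_oneLinkKRModulus (N := 2) hd (by norm_num) zero_le_one hR hmod h'⟩

omit [NeZero L] in
/-- **THE DIMENSION COLUMN, EXACT THRESHOLD**: for every `d ≥ 2` and every Wilson coupling
`0 ≤ β_W < β⋆_G(d) = (√(4d²−8d+5) − (2d−3))/(d−1)` (`d = 3`: `(√17−3)/2 = 0.5616`; `d = 4`:
`(√37−5)/3 = 0.3609`; `d = 5`: `(√65−7)/4 = 0.2656`; `d = 6`: `(√101−9)/5 = 0.2100`), `SU(2)` lattice
Yang–Mills on `ℤ^d` at tree coupling `β_W/2` has exactly one DLR state and a unique thermodynamic limit —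
hypothesis-free (`StarResolventDim.doorCond_iff_lt_sqrt` + `su2_unique_of_door`). [folklore] -/
theorem su2_unique_of_lt_threshold (hd : 2 ≤ d) {βW : ℝ} (h0 : 0 ≤ βW)
    (h : βW < (Real.sqrt (4 * (d : ℝ) ^ 2 - 8 * d + 5) - (2 * (d : ℝ) - 3)) / ((d : ℝ) - 1)) :
    HasUniqueGibbsMeasure (ymSpecification (d := d) (fundamentalRep (Fin 2)) (βW / 2)) ∧
      HasUniqueInfiniteVolumeLimit (d := d) (fundamentalRep (Fin 2)) (βW / 2) := by
  have hd' : (2 : ℝ) ≤ d := by exact_mod_cast hd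
  refine su2_unique_of_door hd h0 ((doorCond_iff_lt_sqrt hd (by linarith : 0 ≤ βW / 4)).2 ?_)
  have h4 : (0 : ℝ) < 4 * ((d : ℝ) - 1) := by linarith
  have h1 : (0 : ℝ) < (d : ℝ) - 1 := by linarith
  rw [lt_div_iff₀ h4]
  rw [lt_div_iff₀ h1] at h
  linarith

omit [NeZero L] in
/-- The door polynomial at `4/3 ×` the single-site door: `P_d(2/(9(d−1))) = 8/9 − 20/(81(d−1)) < 1`
(`d ≥ 2`). [folklore] -/
theorem doorPoly_closedForm_lt_one (hd : 2 ≤ d) : doorPoly d (2 / (9 * ((d : ℝ) - 1))) < 1 := by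
  have hd' : (2 : ℝ) ≤ d := by exact_mod_cast hd
  have he : (0 : ℝ) < (d : ℝ) - 1 := by linarith
  have hval : doorPoly d (2 / (9 * ((d : ℝ) - 1))) = 8 / 9 - 20 / (81 * ((d : ℝ) - 1)) := by
    unfold doorPoly
    field_simp
    ring
  rw [hval]
  have : 0 < 20 / (81 * ((d : ℝ) - 1)) := by positivity
  linarith

omit [NeZero L] in
/-- **`SU(2)`, EVERY `d ≥ 2`, CLOSED FORM**: at every Wilson coupling `0 ≤ β_W ≤ 8/(9(d−1))` — i.e. up to
`4/3 ×` the single-site Dobrushin door `2/(3(d−1))`, uniformly in `d` (the exact star door `β⋆_G(d)` is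
`× 1.85 … 1.5` of it, `su2_unique_of_lt_threshold`) — `SU(2)` lattice Yang–Mills on `ℤ^d` at tree coupling
`β_W/2` has exactly one DLR state and a unique thermodynamic limit. [folklore] -/
theorem su2_unique_of_le_closedForm (hd : 2 ≤ d) {βW : ℝ} (h0 : 0 ≤ βW)
    (h : βW * ((d : ℝ) - 1) ≤ 8 / 9) :
    HasUniqueGibbsMeasure (ymSpecification (d := d) (fundamentalRep (Fin 2)) (βW / 2)) ∧
      HasUniqueInfiniteVolumeLimit (d := d) (fundamentalRep (Fin 2)) (βW / 2) := by
  have hd' : (2 : ℝ) ≤ d := by exact_mod_cast hd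
  have he : (0 : ℝ) < (d : ℝ) - 1 := by linarith
  have hle : βW / 4 ≤ 2 / (9 * ((d : ℝ) - 1)) := by
    rw [le_div_iff₀ (by positivity)]
    nlinarith
  exact su2_unique_of_door hd h0
    (doorPoly_lt_one_mono hd (by linarith) hle (doorPoly_closedForm_lt_one hd))

/-! ### `SU(2)` rows at rational couplings (`d = 3, 4, 5, 6`) -/

omit [NeZero L] in
/-- **`d = 3` (single-site door `β_W < 1/3`)**: `SU(2)` on `ℤ³` has exactly one DLR state and a unique
thermodynamic limit at every `0 ≤ β_W ≤ 5/9 = 0.5556` (`R_G^{(3)}(5/36) = 205/209`). [folklore] -/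
theorem su2_three_unique_le {βW : ℝ} (h0 : 0 ≤ βW) (h : βW ≤ 5 / 9) :
    HasUniqueGibbsMeasure (ymSpecification (d := 3) (fundamentalRep (Fin 2)) (βW / 2)) ∧
      HasUniqueInfiniteVolumeLimit (d := 3) (fundamentalRep (Fin 2)) (βW / 2) :=
  su2_unique_of_door (d := 3) (by norm_num) h0
    (doorPoly_lt_one_mono (by norm_num) (by linarith) (by linarith : βW / 4 ≤ 5 / 36) doorPoly_rows.1)

omit [NeZero L] in
/-- **`d = 4`** (re-derivation through the general-`d` chain; the row of record is
`DSWindowZd.su2_hasUniqueGibbsMeasure_le_9_25`): every `0 ≤ β_W ≤ 9/25`. [folklore] -/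
theorem su2_four_unique_le {βW : ℝ} (h0 : 0 ≤ βW) (h : βW ≤ 9 / 25) :
    HasUniqueGibbsMeasure (ymSpecification (d := 4) (fundamentalRep (Fin 2)) (βW / 2)) ∧
      HasUniqueInfiniteVolumeLimit (d := 4) (fundamentalRep (Fin 2)) (βW / 2) := by
  refine su2_unique_of_door (d := 4) (by norm_num) h0
    (doorPoly_lt_one_mono (by norm_num) (by linarith) (by linarith : βW / 4 ≤ 9 / 100) ?_)
  unfold doorPoly; norm_num

omit [NeZero L] in
/-- **`d = 5` (single-site door `β_W < 1/6`)**: `SU(2)` on `ℤ⁵` has exactly one DLR state and a unique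
thermodynamic limit at every `0 ≤ β_W ≤ 13/50 = 0.26` (`R_G^{(5)}(13/200) = 2769/2881`). [folklore] -/
theorem su2_five_unique_le {βW : ℝ} (h0 : 0 ≤ βW) (h : βW ≤ 13 / 50) :
    HasUniqueGibbsMeasure (ymSpecification (d := 5) (fundamentalRep (Fin 2)) (βW / 2)) ∧
      HasUniqueInfiniteVolumeLimit (d := 5) (fundamentalRep (Fin 2)) (βW / 2) :=
  su2_unique_of_door (d := 5) (by norm_num) h0
    (doorPoly_lt_one_mono (by norm_num) (by linarith) (by linarith : βW / 4 ≤ 13 / 200) doorPoly_rows.2.1)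

omit [NeZero L] in
/-- **`d = 6` (single-site door `β_W < 2/15`)**: `SU(2)` on `ℤ⁶` has exactly one DLR state and a unique
thermodynamic limit at every `0 ≤ β_W ≤ 1/5` (`R_G^{(6)}(1/20) = 21/23`). [folklore] -/
theorem su2_six_unique_le {βW : ℝ} (h0 : 0 ≤ βW) (h : βW ≤ 1 / 5) :
    HasUniqueGibbsMeasure (ymSpecification (d := 6) (fundamentalRep (Fin 2)) (βW / 2)) ∧
      HasUniqueInfiniteVolumeLimit (d := 6) (fundamentalRep (Fin 2)) (βW / 2) :=
  su2_unique_of_door (d := 6) (by norm_num) h0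
    (doorPoly_lt_one_mono (by norm_num) (by linarith) (by linarith : βW / 4 ≤ 1 / 20)
      doorPoly_rows.2.2.1)

/-- **`d = 3` torus clustering row**: `SU(2)` on `(ℤ/L)³`, `L ≥ 3`, every `0 ≤ β_W ≤ 5/9`: covariance
decay of link observables uniformly in `L` with `ρ = R_G^{(3)}(β_W/4) ≤ 205/209`. [folklore] -/
theorem su2_three_abs_covariance_le (hL : 3 ≤ L) {βW : ℝ} (h0 : 0 ≤ βW) (h : βW ≤ 5 / 9)
    {f g : GaugeConfig 3 L (Matrix.specialUnitaryGroup (Fin 2) ℂ) → ℝ} {Δf Δg : Finset (Edge 3 L)}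
    {δf δg : Edge 3 L → ℝ} (hf : LinkObs suFrobDist f Δf δf) (hg : LinkObs suFrobDist g Δg δg)
    (L₀ : ℕ) (hL₀ : ∀ x ∈ Δf, ∀ z ∈ Δg, ∀ a ∈ linkEnds x, ∀ w ∈ linkEnds z, L₀ ≤ torusNorm (a - w)) :
    |cov[f, g; wilsonMeasure (d := 3) (L := L) (fundamentalRep (Fin 2)) (βW / 2)]| ≤
      4 * (2 * Real.sqrt (2 : ℕ)) ^ 2 *
        Real.exp (-((1 - gaugeR 3 (βW / 4)) ^ 2 /
          (2 * (2 * gaugeR 3 (βW / 4) * (2 * 3 : ℕ) + 1)) * L₀)) *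
        (∑ x ∈ Δf, δf x) * ∑ y ∈ Δg, δg y :=
  su2_abs_covariance_le (d := 3) (by norm_num) hL h0
    (doorPoly_lt_one_mono (by norm_num) (by linarith) (by linarith : βW / 4 ≤ 5 / 36) doorPoly_rows.1)
    hf hg L₀ hL₀

/-! ### Every `SU(N)`, `N ≥ 2`, dimension `d`: the hypothesis-free Bakry–Émery modulus -/

omit [NeZero L] in
/-- **`SU(N)`, `N ≥ 2`, dimension `d ≥ 2`, HYPOTHESIS-FREE, TWO-SIDED**: with 't Hooft `x = |β|/N`,
`2(d−1)x < 1/2` and the door at the Bakry–Émery coefficient `c = x/(1/2 − 2(d−1)x)`, the `SU(N)` lattice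
Yang–Mills specification on `ℤ^d` at tree coupling `β` has exactly one DLR state and a unique
thermodynamic limit (`oneLinkKRModulus_SU`, `K = 1/(1/2 − R)` at `R = 2(d−1)x`). [folklore] -/
theorem unique_SU_of_door (hd : 2 ≤ d) (hN : 2 ≤ N) {β : ℝ}
    (hx : |β| / N * (2 * ((d : ℝ) - 1)) < 1 / 2)
    (h : doorPoly d (1 / (1 / 2 - |β| / N * (2 * ((d : ℝ) - 1))) * (|β| / N)) < 1) :
    HasUniqueGibbsMeasure (ymSpecification (d := d) (fundamentalRep (Fin N)) β) ∧
      HasUniqueInfiniteVolumeLimit (d := d) (fundamentalRep (Fin N)) β := by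
  have hK0 : 0 ≤ 1 / (1 / 2 - |β| / N * (2 * ((d : ℝ) - 1))) := by
    have : 0 < 1 / 2 - |β| / N * (2 * ((d : ℝ) - 1)) := by linarith
    positivity
  have hmod := oneLinkKRModulus_SU hN hx
  exact ⟨hasUniqueGibbsMeasure_of_oneLinkKRModulus hd (by omega) hK0 le_rfl hmod h,
    hasUniqueInfiniteVolumeLimit_of_oneLinkKRModulus hd (by omega) hK0 le_rfl hmod h⟩

omit [NeZero L] in
/-- **`SU(N)`, EVERY `N ≥ 2`, EVERY `d ≥ 2`, CLOSED FORM, HYPOTHESIS-FREE, TWO-SIDED**: at every tree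
coupling `β` with `(d−1)|β|/N ≤ 1/12` ('t Hooft `|β|/N ≤ 1/(12(d−1))`; the printed single-site Shen–Zhu–Zhu
window is `1/(16(d−1))`, so this is `× 4/3` uniformly in `d`) the `SU(N)` lattice Yang–Mills specification on
`ℤ^d` has exactly one DLR state and a unique thermodynamic limit.  Arithmetic: the Bakry–Émery constant is
`K = 1/(1/2 − 2(d−1)x) ≤ 3`, so `c ≤ 3x`, and `P_d(3x) = 36(d−1)x² + (12d−18)x ≤ 1 − 3x`. [folklore] -/
theorem unique_SU_of_abs_le (hd : 2 ≤ d) (hN : 2 ≤ N) {β : ℝ}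
    (h : |β| / N * ((d : ℝ) - 1) ≤ 1 / 12) :
    HasUniqueGibbsMeasure (ymSpecification (d := d) (fundamentalRep (Fin N)) β) ∧
      HasUniqueInfiniteVolumeLimit (d := d) (fundamentalRep (Fin N)) β := by
  have hd' : (2 : ℝ) ≤ d := by exact_mod_cast hd
  have hN0 : (0 : ℝ) < N := by exact_mod_cast (show 0 < N by omega)
  have hx0 : 0 ≤ |β| / N := div_nonneg (abs_nonneg β) hN0.le
  have hu : |β| / N * (2 * ((d : ℝ) - 1)) ≤ 1 / 6 := by nlinarith
  have hx : |β| / N * (2 * ((d : ℝ) - 1)) < 1 / 2 := by linarith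
  refine unique_SU_of_door hd hN hx ?_
  have hpos : (1 : ℝ) / 3 ≤ 1 / 2 - |β| / N * (2 * ((d : ℝ) - 1)) := by linarith
  have hpos' : (0 : ℝ) < 1 / 2 - |β| / N * (2 * ((d : ℝ) - 1)) := by linarith
  have hK3 : 1 / (1 / 2 - |β| / N * (2 * ((d : ℝ) - 1))) ≤ 3 := by
    rw [div_le_iff₀ hpos']; linarith
  have hc0 : 0 ≤ 1 / (1 / 2 - |β| / N * (2 * ((d : ℝ) - 1))) * (|β| / N) :=
    mul_nonneg (one_div_pos.2 hpos').le hx0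
  have hcle : 1 / (1 / 2 - |β| / N * (2 * ((d : ℝ) - 1))) * (|β| / N) ≤ 3 * (|β| / N) :=
    mul_le_mul_of_nonneg_right hK3 hx0
  refine doorPoly_lt_one_mono hd hc0 hcle ?_
  unfold doorPoly
  set x := |β| / (N : ℝ) with hxdef
  have h36 : 36 * ((d : ℝ) - 1) * x ^ 2 ≤ 3 * x := by
    have : 36 * ((d : ℝ) - 1) * x ^ 2 = 36 * x * (x * ((d : ℝ) - 1)) := by ring
    rw [this]
    nlinarith
  have h12 : (12 * (d : ℝ) - 18) * x ≤ 1 - 6 * x := by nlinarith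
  rcases eq_or_lt_of_le hx0 with hzero | hpos
  · rw [← hzero]; norm_num
  · nlinarith

omit [NeZero L] in
/-- **`SU(N)`, `N ≥ 2`, `d = 3` row**: exactly one DLR state on `ℤ³` and a unique thermodynamic limit at
every tree coupling `β` with `|β|/N ≤ 2/45 = 0.0444…` ('t Hooft; the printed single-site Shen–Zhu–Zhu bar in
`d = 3` is `1/(16(d−1)) = 1/32 = 0.03125`): at `x = 2/45` the Bakry–Émery coefficient is `c = 4/29` and
`8c² + 6c = 824/841 < 1`. [folklore] -/
theorem unique_SU_three_of_abs_le (hN : 2 ≤ N) {β : ℝ} (h : |β| / N ≤ 2 / 45) :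
    HasUniqueGibbsMeasure (ymSpecification (d := 3) (fundamentalRep (Fin N)) β) ∧
      HasUniqueInfiniteVolumeLimit (d := 3) (fundamentalRep (Fin N)) β := by
  have hN0 : (0 : ℝ) < N := by exact_mod_cast (show 0 < N by omega)
  have hx0 : 0 ≤ |β| / N := div_nonneg (abs_nonneg β) hN0.le
  have hx : |β| / N * (2 * (((3 : ℕ) : ℝ) - 1)) < 1 / 2 := by push_cast; linarith
  refine unique_SU_of_door (d := 3) (by norm_num) hN hx ?_
  -- the coefficient is at most `4/29`, where the door polynomial is `824/841 < 1`
  have hpos : 0 < 1 / 2 - |β| / N * (2 * (((3 : ℕ) : ℝ) - 1)) := by linarith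
  have hc0 : 0 ≤ 1 / (1 / 2 - |β| / N * (2 * (((3 : ℕ) : ℝ) - 1))) * (|β| / N) :=
    mul_nonneg (one_div_pos.2 hpos).le hx0
  have hcle : 1 / (1 / 2 - |β| / N * (2 * (((3 : ℕ) : ℝ) - 1))) * (|β| / N) ≤ 4 / 29 := by
    rw [one_div_mul_eq_div, div_le_iff₀ hpos]
    push_cast
    linarith
  refine doorPoly_lt_one_mono (by norm_num) hc0 hcle ?_
  unfold doorPoly; norm_num

end Summit.Ventures.YMGap.StarDimRows

end
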